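import Summits.NavierStokesRegularity.NavierStokesRegularity.Theses.RigidMotionDoor
import Literature.Analysis.FluidPDE.KNSSLineInvariantLiouville
import Literature.Analysis.FluidPDE.TypeIAncientMild
import HarnessLib

/-!
# RigidMotionDoor — item `TranslationEndLiouville` (stmt-NavierStokesRegularity-27904, support, LINE g5-3, ns-idea-6 g5): a Type-I
# ancient mild field infinitesimally invariant under a translation on an end `(−∞, θ)` vanishes there

Exactly the planner's tree-backed plan: shift time by `−θ` (`IsTypeIAncientMild.comp_sub_right`) to work on `(−∞,0)`; integrate the
infinitesimal invariance `∂_e u(t) ≡ 0` along the line `δ ↦ x + δe` (the slices are smooth — `IsTypeIAncientMild` is jointly `C^∞` —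
so `fderiv` is the genuine derivative and `is_const_of_deriv_eq_zero` applies); shift once more by `−s/2` into the bounded ancient
class (`IsTypeIAncientMild.isBoundedAncientMildSolution_sub`) and apply KNSS Thm 5.1 in the tree's form
`apply_eq_apply_zero_of_invariant_along` (translation-invariant bounded ancient mild ⇒ spatially constant slices); the gauge kills
slice-constant members (`IsTypeIAncientMild.eq_zero_of_slice_const`).

Prover ns-imp-p1 g4 (prepared while FREE; lands `--workitem stmt-NavierStokesRegularity-27904` only once route RigidMotionDoor is
open/staffable and the director keys it, DIRECTOR-NS #224 (1)(c)).  WHAT THIS IS NOT: a support lemma about HYPOTHETICAL Type-I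
ancient profiles; the door `RigidMotionDoor.Target`, item 0056 and NS regularity are NOT proved.
-/

noncomputable section

set_option linter.dupNamespace false

namespace Summit.NavierStokesRegularity.NavierStokesRegularity.Theorems

open Set Function Filter Topology
open Literature.Analysis Literature.Analysis.FluidPDE

/-- Slices of a Type-I ancient mild field are differentiable. -/
theorem differentiableAt_slice_of_isTypeIAncientMild {C : ℝ}
    {u : ℝ → EuclideanSpace ℝ (Fin 3) → EuclideanSpace ℝ (Fin 3)} (hu : IsTypeIAncientMild C u) {s : ℝ} (hs : s < 0)
    (x : EuclideanSpace ℝ (Fin 3)) : DifferentiableAt ℝ (u s) x := by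
  have hO : IsOpen (Iio (0 : ℝ) ×ˢ (univ : Set (EuclideanSpace ℝ (Fin 3)))) := isOpen_Iio.prod isOpen_univ
  have h1 : ContDiffAt ℝ (⊤ : ℕ∞) (uncurry u) (s, x) := hu.1.contDiffAt (hO.mem_nhds ⟨hs, mem_univ _⟩)
  have h2 : ContDiffAt ℝ (⊤ : ℕ∞) (u s) x := h1.comp x (contDiffAt_const.prodMk contDiffAt_id)
  exact h2.differentiableAt (by simp)

/-- **Integrating an infinitesimal translation symmetry of a smooth slice**: `∂_e f ≡ 0` with `f` differentiable ⇒
`f (x + δ e) = f x`. -/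
theorem apply_add_smul_eq_of_fderiv_apply_eq_zero {f : EuclideanSpace ℝ (Fin 3) → EuclideanSpace ℝ (Fin 3)}
    (hf : Differentiable ℝ f) {e : EuclideanSpace ℝ (Fin 3)} (he : ∀ x, fderiv ℝ f x e = 0)
    (x : EuclideanSpace ℝ (Fin 3)) (δ : ℝ) : f (x + δ • e) = f x := by
  set g : ℝ → EuclideanSpace ℝ (Fin 3) := fun τ => f (x + τ • e) with hg
  have hline : ∀ τ : ℝ, HasDerivAt (fun τ : ℝ => x + τ • e) e τ := fun τ => by
    simpa using ((hasDerivAt_id τ).smul_const e).const_add x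
  have hderiv : ∀ τ : ℝ, HasDerivAt g 0 τ := by
    intro τ
    have h := (hf (x + τ • e)).hasFDerivAt.comp_hasDerivAt τ (hline τ)
    rw [he] at h
    exact h
  have hconst := is_const_of_deriv_eq_zero (fun τ => (hderiv τ).differentiableAt) (fun τ => (hderiv τ).deriv) δ 0
  simpa [hg] using hconst

/-- **Item 27904 `RigidMotionDoor.TranslationEndLiouville`, by name.** -/
theorem rigidMotionDoor_translationEndLiouville_proof : Theses.RigidMotionDoor.TranslationEndLiouville := by
  intro C u hu e θ he hθ hder t ht x
  -- shift to the whole past: `w τ = u (τ + θ)`, `τ < 0`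
  have hw : IsTypeIAncientMild C (fun τ => u (τ - (-θ))) := hu.comp_sub_right (δ := -θ) (by linarith)
  set w : ℝ → EuclideanSpace ℝ (Fin 3) → EuclideanSpace ℝ (Fin 3) := fun τ => u (τ - (-θ)) with hw_def
  -- integrated translation invariance of every slice of `w`
  have hinv : ∀ τ < 0, ∀ (y : EuclideanSpace ℝ (Fin 3)) (δ : ℝ), w τ (y + δ • e) = w τ y := by
    intro τ hτ y δ
    have hτθ : τ - (-θ) < θ := by linarith
    refine apply_add_smul_eq_of_fderiv_apply_eq_zero (fun z => differentiableAt_slice_of_isTypeIAncientMild hw hτ z)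
      (fun z => ?_) y δ
    exact hder (τ - (-θ)) hτθ z
  -- every slice of `w` is constant (KNSS Thm 5.1 on the bounded shifted field)
  have hconst : ∀ s < 0, ∀ y, w s y = w s 0 := by
    intro s hs y
    have hδ : 0 < -s / 2 := by linarith
    have hb := hw.isBoundedAncientMildSolution_sub hδ
    have hcont : ContinuousOn (uncurry fun τ => w (τ - -s / 2)) (Iio (0 : ℝ) ×ˢ univ) :=
      (hw.comp_sub_right hδ.le).continuousOn_uncurry
    have hinv' : ∀ τ < 0, ∀ (y : EuclideanSpace ℝ (Fin 3)) (δ : ℝ),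
        (fun τ => w (τ - -s / 2)) τ (y + δ • e) = (fun τ => w (τ - -s / 2)) τ y :=
      fun τ hτ y δ => hinv (τ - -s / 2) (by linarith) y δ
    have h := apply_eq_apply_zero_of_invariant_along he hb hcont hinv' (s / 2) (by linarith) y
    have e1 : s / 2 - -s / 2 = s := by ring
    simpa [e1] using h
  -- the gauge kills slice-constant members
  have hzero : ∀ τ < 0, ∀ y, w τ y = 0 := fun τ hτ y =>
    hw.eq_zero_of_slice_const (b := fun s => w s 0) hconst hτ y
  have h := hzero (t - θ) (by linarith) x
  simpa [hw_def] using h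

end Summit.NavierStokesRegularity.NavierStokesRegularity.Theorems

end
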